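import Mathlib
import Summits.Ventures.DiscreteObjects.Mahler.CyclotomicIntegerLehmer

/-!
# Cyclotomic integers, ramified prime: the Bombieri–Gubler Case II inequality (venture `DiscreteObjects`, target L)

Cell `pub-namedobj`, seat `pub-namedobj-mahler-g27`. Framing: lottery ticket; floor = certified bounds/negative ranges.

[cite: BombieriGubler2001, Theorem 4.4.9, proof of Case II with Lemma 4.4.13(b)] (Amoroso–Dvornicich 2000): for a prime
`p` DIVIDING `m` and `σ = σ_k ∈ Gal(ℚ(ζ_m)/ℚ(ζ_m^p))`, `ζ_m ↦ ζ_m^k` with `k ≡ 1 (mod m/p)`, every cyclotomic integer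
`γ = g(ζ_m)` satisfies `p ∣ γ^p - σ(γ^p)`; with `η = α^p - σ(α^p) ≠ 0` the product formula gives `h(α) ≥ log(p/2)/(2p)`.
KERNEL FORM over `ℂ` (`cyclotomicInteger_measure_bound_ramified`): for `g ∈ ℤ[X]`, `p ∣ m`, `k` prime to `m` with
`k ≡ 1 (mod m/p)`, and `g(μ)^p ≠ g(μ^k)^p` for every primitive `m`-th root of unity `μ` (the NONDEGENERATE case):
**`(p/2)^{φ(m)} ≤ (∏_μ max(1, |g(μ)|))^{2p}`**, and in Mahler-measure form **`(p/2)^{deg α} ≤ M(α)^{2p}`**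
(`cyclotomicInteger_lehmer_bound_ramified`).  Method as in `CyclotomicIntegerMeasure`: from `g^p - g(X^p) = p·T` and
`μ^{kp} = μ^p`, `g(μ)^p - g(μ^k)^p = p (T(μ) - T(μ^k))`, and `∏_μ (T(μ) - T(μ^k)) = Res(Φ_m, T - T(X^k))` is a nonzero
integer.  The degenerate case (`α^p` fixed by `σ`) is where the printed proof descends to `ℚ(ζ_{m/p})`; that descent
(an integral-basis statement for `ℤ[ζ_m]` over `ℤ[ζ_m^p]`) is NOT done here, so Lehmer's conjecture for ALL cyclotomic
integers remains open in the tree — see `CyclotomicIntegerLehmer` for the unramified primes `p ≤ 31`.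
REPLICATION, no new mathematics.
-/

namespace Summit.Ventures.DiscreteObjects.Mahler

open Polynomial Finset

/-- For `p ∣ m` and `k ≡ 1 (mod m/p)`: `μ^{kp} = μ^p` for every `m`-th root of unity `μ`. -/
theorem pow_mul_eq_pow_of_mod {m p k : ℕ} (hpm : p ∣ m) (hk : k % (m / p) = 1 % (m / p)) (hk1 : 1 ≤ k) {μ : ℂ}
    (hμ : μ ^ m = 1) : μ ^ (k * p) = μ ^ p := by
  rcases Nat.eq_zero_or_pos p with hp0 | hp
  · subst hp0; simp
  obtain ⟨n, hn⟩ := hpm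
  have hnp : m / p = n := by rw [hn, Nat.mul_div_cancel_left n hp]
  rw [hnp] at hk
  have hdvd : n ∣ k - 1 := by
    rw [Nat.dvd_iff_mod_eq_zero]
    exact Nat.sub_mod_eq_zero_of_mod_eq hk
  obtain ⟨t, ht⟩ := hdvd
  have hk' : k = 1 + n * t := by omega
  rw [hk', add_mul, one_mul, pow_add, mul_comm n t, mul_assoc, mul_comm n p, ← hn, mul_comm t m, pow_mul, hμ, one_pow,
    mul_one]

/-- **[BombieriGubler2001, Theorem 4.4.9, Case II], nondegenerate part, kernel form.**  Let `p` be a prime dividing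
`m`, `k` prime to `m` with `k ≡ 1 (mod m/p)`, and `g ∈ ℤ[X]` with `g(μ)^p ≠ g(μ^k)^p` for every primitive `m`-th root
of unity `μ`.  Then `(p/2)^{φ(m)} ≤ (∏_μ max(1, |g(μ)|))^{2p}`. -/
theorem cyclotomicInteger_measure_bound_ramified {m p k : ℕ} (hm : 0 < m) (hp : p.Prime) (hpm : p ∣ m)
    (hk : k % (m / p) = 1 % (m / p)) (hkcop : k.Coprime m) (g : ℤ[X])
    (hsep : ∀ μ ∈ primitiveRoots m ℂ, aeval μ g ^ p ≠ aeval (μ ^ k) g ^ p) :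
    ((p : ℝ) / 2) ^ m.totient ≤ (∏ μ ∈ primitiveRoots m ℂ, max 1 ‖aeval μ g‖) ^ (2 * p) := by
  classical
  set Φ : ℤ[X] := cyclotomic m ℤ with hΦ
  have hΦmon : Φ.Monic := cyclotomic.monic m ℤ
  have hΦdeg : Φ.natDegree = m.totient := natDegree_cyclotomic m ℤ
  set ζ₀ : ℂ := Complex.exp (2 * Real.pi * Complex.I / m) with hζ₀def
  have hζ₀ : IsPrimitiveRoot ζ₀ m := Complex.isPrimitiveRoot_exp m hm.ne'
  have hroots : (Φ.map (Int.castRingHom ℂ)).roots = (primitiveRoots m ℂ).val := by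
    rw [hΦ, map_cyclotomic_int, cyclotomic_eq_prod_X_sub_primitiveRoots hζ₀, roots_prod_X_sub_C]
  have hlc : (Φ.map (Int.castRingHom ℂ)).leadingCoeff = 1 := (hΦmon.map _).leadingCoeff
  have hcard : (primitiveRoots m ℂ).card = m.totient := hζ₀.card_primitiveRoots
  have hk1 : 1 ≤ k := by
    rcases Nat.eq_zero_or_pos k with h0 | h
    · exfalso
      rw [h0, Nat.coprime_zero_left] at hkcop
      rw [hkcop] at hpm
      exact hp.one_lt.ne' (Nat.dvd_one.1 hpm)
    · exact h
  -- `g^p - g(X^p) = p T`, `U = T - T(X^k)`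
  obtain ⟨T, hT⟩ := exists_pow_sub_expand_eq_prime_mul g hp
  set U : ℤ[X] := T - expand ℤ k T with hU
  have hTμ : ∀ z : ℂ, aeval z g ^ p - aeval (z ^ p) g = (p : ℂ) * aeval z T := by
    intro z
    have h := congrArg (aeval z) hT
    rw [map_sub, map_pow, expand_aeval, map_mul, aeval_C, algebraMap_int_eq, eq_intCast] at h
    exact h
  have hη : ∀ μ ∈ primitiveRoots m ℂ, aeval μ g ^ p - aeval (μ ^ k) g ^ p = (p : ℂ) * aeval μ U := by
    intro μ hμ
    have hμ' := (mem_primitiveRoots hm).1 hμ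
    have hkp : (μ ^ k) ^ p = μ ^ p := by rw [← pow_mul]; exact pow_mul_eq_pow_of_mod hpm hk hk1 hμ'.pow_eq_one
    have h1 := hTμ μ
    have h2 := hTμ (μ ^ k)
    rw [hkp] at h2
    rw [hU, map_sub, expand_aeval]
    linear_combination h1 - h2
  -- `∏_μ U(μ) = Res(Φ, U)`, a nonzero integer
  set N : ℕ := U.natDegree with hN
  have hev : ((Φ.resultant U Φ.natDegree N : ℤ) : ℂ) = ∏ μ ∈ primitiveRoots m ℂ, aeval μ U := by
    rw [resultant_intCast_eq le_rfl, hlc, one_pow, one_mul, hroots]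
    change ∏ μ ∈ primitiveRoots m ℂ, (U.map (Int.castRingHom ℂ)).eval μ = _
    refine Finset.prod_congr rfl fun μ _ => ?_
    rw [eval_map, ← algebraMap_int_eq, ← aeval_def]
  have hne : Φ.resultant U Φ.natDegree N ≠ 0 := by
    intro h0
    have h := hev
    rw [h0, Int.cast_zero] at h
    refine (Finset.prod_ne_zero_iff.2 fun μ hμ => ?_) h.symm
    intro hU0
    have := hη μ hμ
    rw [hU0, mul_zero, sub_eq_zero] at this
    exact hsep μ hμ this
  have hprod : ∏ μ ∈ primitiveRoots m ℂ, (aeval μ g ^ p - aeval (μ ^ k) g ^ p) =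
      (p : ℂ) ^ m.totient * ∏ μ ∈ primitiveRoots m ℂ, aeval μ U := by
    rw [Finset.prod_congr rfl hη, Finset.prod_mul_distrib, Finset.prod_const, hcard]
  -- lower bound
  have hlow : (p : ℝ) ^ m.totient ≤ ‖∏ μ ∈ primitiveRoots m ℂ, (aeval μ g ^ p - aeval (μ ^ k) g ^ p)‖ := by
    rw [hprod, norm_mul, norm_pow, Complex.norm_natCast, ← hev, Complex.norm_intCast]
    have h1 : (1 : ℝ) ≤ |(Φ.resultant U Φ.natDegree N : ℝ)| := by exact_mod_cast Int.one_le_abs hne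
    calc (p : ℝ) ^ m.totient = (p : ℝ) ^ m.totient * 1 := (mul_one _).symm
      _ ≤ (p : ℝ) ^ m.totient * |(Φ.resultant U Φ.natDegree N : ℝ)| :=
          mul_le_mul_of_nonneg_left h1 (by positivity)
  -- upper bound
  set H : ℝ := ∏ μ ∈ primitiveRoots m ℂ, max 1 ‖aeval μ g‖ with hH
  have hH0 : 0 ≤ H := Finset.prod_nonneg fun μ _ => by positivity
  have hup : ‖∏ μ ∈ primitiveRoots m ℂ, (aeval μ g ^ p - aeval (μ ^ k) g ^ p)‖ ≤ 2 ^ m.totient * H ^ p * H ^ p := by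
    rw [norm_prod]
    calc ∏ μ ∈ primitiveRoots m ℂ, ‖aeval μ g ^ p - aeval (μ ^ k) g ^ p‖
        ≤ ∏ μ ∈ primitiveRoots m ℂ, (2 * (max 1 ‖aeval μ g‖) ^ p * (max 1 ‖aeval (μ ^ k) g‖) ^ p) := by
          refine Finset.prod_le_prod (fun μ _ => norm_nonneg _) fun μ _ => ?_
          have ha : ‖aeval μ g ^ p‖ ≤ (max 1 ‖aeval μ g‖) ^ p := by
            rw [norm_pow]; exact pow_le_pow_left₀ (norm_nonneg _) (le_max_right _ _) _
          have hb : ‖aeval (μ ^ k) g ^ p‖ ≤ (max 1 ‖aeval (μ ^ k) g‖) ^ p := by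
            rw [norm_pow]; exact pow_le_pow_left₀ (norm_nonneg _) (le_max_right _ _) _
          calc ‖aeval μ g ^ p - aeval (μ ^ k) g ^ p‖ ≤ ‖aeval μ g ^ p‖ + ‖aeval (μ ^ k) g ^ p‖ := norm_sub_le _ _
            _ ≤ (max 1 ‖aeval μ g‖) ^ p + (max 1 ‖aeval (μ ^ k) g‖) ^ p := add_le_add ha hb
            _ ≤ 2 * (max 1 ‖aeval μ g‖) ^ p * (max 1 ‖aeval (μ ^ k) g‖) ^ p :=
                add_le_two_mul_mul (one_le_pow₀ (le_max_left _ _)) (one_le_pow₀ (le_max_left _ _))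
      _ = 2 ^ m.totient * H ^ p * (∏ μ ∈ primitiveRoots m ℂ, max 1 ‖aeval (μ ^ k) g‖) ^ p := by
          rw [Finset.prod_mul_distrib, Finset.prod_mul_distrib, Finset.prod_const, hcard, Finset.prod_pow,
            Finset.prod_pow]
      _ = 2 ^ m.totient * H ^ p * H ^ p := by
          rw [prod_primitiveRoots_pow_eq hm hkcop (fun z => max 1 ‖aeval z g‖)]
  have h := hlow.trans hup
  rw [div_pow, div_le_iff₀ (by positivity), two_mul, pow_add]
  linarith

/-- **The ramified bound in Mahler-measure form** (nondegenerate case of [BombieriGubler2001, Thm 4.4.9, Case II]):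
`ζ` a primitive `m`-th root of unity, `p ∣ m` prime, `k` prime to `m` with `k ≡ 1 (mod m/p)`, `α = g(ζ) ≠ 0` not a root
of unity with `g(μ)^p ≠ g(μ^k)^p` for all primitive `μ`: then `(p/2)^{deg α} ≤ M(α)^{2p}`. -/
theorem cyclotomicInteger_lehmer_bound_ramified {m p k : ℕ} (hm : 0 < m) (hp : p.Prime) (hpm : p ∣ m)
    (hk : k % (m / p) = 1 % (m / p)) (hkcop : k.Coprime m) (g : ℤ[X]) {ζ : ℂ} (hζ : IsPrimitiveRoot ζ m)
    (hsep : ∀ μ ∈ primitiveRoots m ℂ, aeval μ g ^ p ≠ aeval (μ ^ k) g ^ p) :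
    ((p : ℝ) / 2) ^ (minpoly ℤ (aeval ζ g)).natDegree ≤ intMahlerMeasure (minpoly ℤ (aeval ζ g)) ^ (2 * p) := by
  classical
  set α : ℂ := aeval ζ g with hα
  have hζint : IsIntegral ℤ ζ := hζ.isIntegral hm
  have hαint : IsIntegral ℤ α := by
    have hmem : α ∈ Algebra.adjoin ℤ {ζ} := by
      rw [hα]
      exact Polynomial.aeval_mem_adjoin_singleton ℤ ζ
    exact (mem_integralClosure_iff ℤ ℂ).1 (adjoin_le_integralClosure hζint hmem)
  set f : ℤ[X] := minpoly ℤ α with hf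
  have hfmon : f.Monic := minpoly.monic hαint
  have hfirr : Irreducible f := minpoly.irreducible hαint
  have hroot : ∀ μ : ℂ, IsPrimitiveRoot μ m → aeval (aeval μ g) f = 0 := by
    intro μ hμ
    have h1 : aeval ζ (f.comp g) = 0 := by rw [aeval_comp, hf, minpoly.aeval]
    have h2 := aeval_eq_zero_of_primitiveRoot hm hζ h1 hμ
    rwa [aeval_comp] at h2
  set Fc : ℂ[X] := ∏ μ ∈ primitiveRoots m ℂ, (X - C (aeval μ g)) with hFc
  have hFcmon : Fc.Monic := monic_prod_of_monic _ _ (fun _ _ => monic_X_sub_C _)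
  obtain ⟨F, hFmap, hFdeg, hFmon⟩ :=
    lifts_and_natDegree_eq_and_monic (prod_X_sub_C_aeval_primitiveRoots_lifts hm g) hFcmon
  have hFcdeg : Fc.natDegree = m.totient := by
    rw [hFc, natDegree_prod_of_monic _ _ (fun _ _ => monic_X_sub_C _)]
    simp only [natDegree_X_sub_C, Finset.sum_const, smul_eq_mul, mul_one]
    exact (Complex.isPrimitiveRoot_exp m hm.ne').card_primitiveRoots
  have hFroots : ∀ z : ℂ, z ∈ (F.map (Int.castRingHom ℂ)).roots → aeval z f = 0 := by
    intro z hz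
    have hmm : ((primitiveRoots m ℂ).val.map fun μ => X - C (aeval μ g)) =
        (((primitiveRoots m ℂ).val.map fun μ => aeval μ g).map fun a : ℂ => X - C a) := by
      rw [Multiset.map_map]
      rfl
    rw [hFmap, Finset.prod_eq_multiset_prod, hmm, roots_multiset_prod_X_sub_C, Multiset.mem_map] at hz
    obtain ⟨μ, hμ, rfl⟩ := hz
    exact hroot μ ((mem_primitiveRoots hm).1 (Finset.mem_def.2 hμ))
  obtain ⟨e, hFe⟩ := eq_pow_of_roots_subset hfmon hfirr _ F rfl hFmon hFroots
  have hed : e * f.natDegree = m.totient := by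
    rw [← hFcdeg, ← hFdeg, hFe, natDegree_pow]
  have he0 : e ≠ 0 := by
    intro he
    rw [he, zero_mul] at hed
    exact (Nat.totient_pos.2 hm).ne' hed.symm
  have hMF : intMahlerMeasure F = ∏ μ ∈ primitiveRoots m ℂ, max 1 ‖aeval μ g‖ := by
    unfold intMahlerMeasure
    rw [hFmap, mahlerMeasure_prod_X_sub_C]
  have hMFe : intMahlerMeasure F = intMahlerMeasure f ^ e := by rw [hFe, intMahlerMeasure_pow]
  have hB := cyclotomicInteger_measure_bound_ramified hm hp hpm hk hkcop g hsep
  rw [← hMF, hMFe, ← hed, ← pow_mul, mul_comm e, pow_mul, pow_mul, ← pow_mul (intMahlerMeasure f) e,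
    mul_comm e (2 * p), pow_mul] at hB
  have hM0 : 0 ≤ intMahlerMeasure f := le_trans zero_le_one (one_le_intMahlerMeasure hfmon.ne_zero)
  exact (pow_le_pow_iff_left₀ (by positivity) (by positivity) he0).1 hB

end Summit.Ventures.DiscreteObjects.Mahler
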